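import Literature.AlgebraicGeometry.Motives.EtalePullback
import HarnessLib

/-!
# `Ext.mapExactFunctor` along composites, the identity, and natural isomorphisms of exact functors

Mathlib's `Abelian.Ext.mapExactFunctor F : Extⁿ(X, Y) → Extⁿ(F X, F Y)` for an exact functor `F`
comes with compatibility with `mk₀`, composition of classes and connecting classes
(`mapExactFunctor_mk₀`, `_comp`, `_extClass`), but with no lemma relating it to the composition of
functors, to the identity functor, or to naturally isomorphic functors (recorded as missing in
`EtalePullback.lean`, whose `ext_deltaMorphism` — uniqueness of `δ`-morphisms out of `Extⁿ(A, –)`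
by dimension shifting, Milne III Rem. 1.6 (c) / Grothendieck, Tôhoku 2.2.1 — was the substitute,
applied case by case in `EtalePullbackComp.lean`). This file proves the three general statements
once, for a source category with enough injectives:

* `Ext.mapExactFunctor_functorComp`: `y.map(Φ ⋙ Ψ) = (y.map Φ).map Ψ`;
* `Ext.mapExactFunctor_functorId`: `y.map(𝟭) = y`;
* `Ext.mapExactFunctor_functorIso`: for `e : Φ₁ ≅ Φ₂`,
  `e⁻¹_A ∘ y.map(Φ₁) ∘ e_F = y.map(Φ₂)` — transport of `mapExactFunctor` along a natural
  isomorphism of exact functors (using Mathlib's `ShortExact.extClass_naturality` for the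
  `δ`-compatibility).

They turn the functoriality statements for pull-backs on sheaf cohomology (`(g ∘ f)^* = f^* ∘ g^*`,
`𝟙^* = id`, independence of the inverse image up to isomorphism, commutation of restriction of
scalars with inverse images) into short computations in degree `0`.

## References

* J. S. Milne, *Étale cohomology* (reissue 2025), III Remark 1.6 (c) (maps on cohomology "induced
  by the obvious map on `H⁰` and the universal property of derived functors"). [Milne2025]
* A. Grothendieck, *Sur quelques points d'algèbre homologique*, Tôhoku Math. J. 9 (1957), 2.2.1.

## Design notes

* Mathlib searches: `grep -n "mapExactFunctor" Mathlib/Algebra/Homology/DerivedCategory/Ext/Map.lean`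
  — only `_hom`, `_zero`, `_add`, `_mk₀`, `₀`, `_comp`, `_extClass`, `_smul`; nothing on `⋙`, `𝟭`
  or natural isomorphisms (Mathlib pin of this tree).
-/

universe w w' w'' v v' v'' u u' u''

open CategoryTheory CategoryTheory.Limits CategoryTheory.Abelian

namespace Literature.AlgebraicGeometry.Motives

variable {C : Type u} [Category.{v} C] [Abelian C] [EnoughInjectives C] [HasExt.{w} C]
variable {D : Type u'} [Category.{v'} D] [Abelian D] [HasExt.{w'} D]
variable {E : Type u''} [Category.{v''} E] [Abelian E] [HasExt.{w''} E]

set_option backward.isDefEq.respectTransparency false in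
/-- **`mapExactFunctor` of a composite of exact functors** is the composite of the
`mapExactFunctor`s: `y.map(Φ ⋙ Ψ) = (y.map Φ).map Ψ`. Both sides are `δ`-morphisms out of
`Extⁿ(A, –)` agreeing on `mk₀` (`ext_deltaMorphism`). [folklore] -/
theorem Ext.mapExactFunctor_functorComp (Φ : C ⥤ D) [Φ.Additive] [PreservesFiniteLimits Φ]
    [PreservesFiniteColimits Φ] (Ψ : D ⥤ E) [Ψ.Additive] [PreservesFiniteLimits Ψ]
    [PreservesFiniteColimits Ψ] [(Φ ⋙ Ψ).Additive] [PreservesFiniteLimits (Φ ⋙ Ψ)]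
    [PreservesFiniteColimits (Φ ⋙ Ψ)] {A F : C} {n : ℕ} (y : Ext A F n) :
    y.mapExactFunctor (Φ ⋙ Ψ) = (y.mapExactFunctor Φ).mapExactFunctor Ψ := by
  have key := ext_deltaMorphism (Φ ⋙ Ψ) (A := A) (B := (Φ ⋙ Ψ).obj A)
    (fun F n y => y.mapExactFunctor (Φ ⋙ Ψ))
    (fun F n y => (y.mapExactFunctor Φ).mapExactFunctor Ψ) ?_ ?_ ?_
  · exact congrFun (congrFun (congrFun key F) n) y
  · intro S hS n x
    rw [Ext.mapExactFunctor_comp, Ext.mapExactFunctor_extClass]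
  · intro S hS n x
    change ((x.comp hS.extClass rfl).mapExactFunctor Φ).mapExactFunctor Ψ =
      ((x.mapExactFunctor Φ).mapExactFunctor Ψ).comp
        ((hS.map_of_exact Φ).map_of_exact Ψ).extClass rfl
    rw [Ext.mapExactFunctor_comp, Ext.mapExactFunctor_extClass, Ext.mapExactFunctor_comp]
    exact congrArg (fun z => ((x.mapExactFunctor Φ).mapExactFunctor Ψ).comp z rfl)
      (Ext.mapExactFunctor_extClass Ψ (hS.map_of_exact Φ))
  · intro F x
    obtain ⟨g, rfl⟩ := (Ext.mk₀_bijective _ _).2 x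
    rw [Ext.mapExactFunctor_mk₀, Ext.mapExactFunctor_mk₀, Ext.mapExactFunctor_mk₀]
    rfl

set_option backward.isDefEq.respectTransparency false in
/-- **`mapExactFunctor` of the identity functor is the identity**: `y.map(𝟭) = y`. [folklore] -/
theorem Ext.mapExactFunctor_functorId [(𝟭 C).Additive] [PreservesFiniteLimits (𝟭 C)]
    [PreservesFiniteColimits (𝟭 C)] {A F : C} {n : ℕ} (y : Ext A F n) :
    y.mapExactFunctor (𝟭 C) = y := by
  have key := ext_deltaMorphism (𝟭 C) (A := A) (B := A)
    (fun F n y => y.mapExactFunctor (𝟭 C)) (fun F n y => y) ?_ ?_ ?_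
  · exact congrFun (congrFun (congrFun key F) n) y
  · intro S hS n x
    rw [Ext.mapExactFunctor_comp, Ext.mapExactFunctor_extClass]
  · intro S hS n x
    rfl
  · intro F x
    obtain ⟨g, rfl⟩ := (Ext.mk₀_bijective _ _).2 x
    change (Ext.mk₀ g).mapExactFunctor (𝟭 C) = Ext.mk₀ g
    rw [Ext.mapExactFunctor_mk₀]
    rfl

set_option backward.isDefEq.respectTransparency false in
/-- **Transport of `mapExactFunctor` along a natural isomorphism of exact functors**: for
`e : Φ₁ ≅ Φ₂` and `y ∈ Extⁿ(A, F)`, `e⁻¹_A ∘ y.map(Φ₁) ∘ e_F = y.map(Φ₂)` in `Extⁿ(Φ₂ A, Φ₂ F)`. The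
left side is a `δ`-morphism because `e` induces isomorphisms of the short exact sequences
`Φ₁ S ≅ Φ₂ S` (Mathlib `ShortExact.extClass_naturality`); in degree `0` this is the naturality of
`e`. [folklore] -/
theorem Ext.mapExactFunctor_functorIso {Φ₁ Φ₂ : C ⥤ D} [Φ₁.Additive] [PreservesFiniteLimits Φ₁]
    [PreservesFiniteColimits Φ₁] [Φ₂.Additive] [PreservesFiniteLimits Φ₂]
    [PreservesFiniteColimits Φ₂] (e : Φ₁ ≅ Φ₂) {A F : C} {n : ℕ} (y : Ext A F n) :
    (Ext.mk₀ (e.inv.app A)).comp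
        ((y.mapExactFunctor Φ₁).comp (Ext.mk₀ (e.hom.app F)) (add_zero n)) (zero_add n) =
      y.mapExactFunctor Φ₂ := by
  have key := ext_deltaMorphism Φ₂ (A := A) (B := Φ₂.obj A)
    (fun F n y => (Ext.mk₀ (e.inv.app A)).comp
      ((y.mapExactFunctor Φ₁).comp (Ext.mk₀ (e.hom.app F)) (add_zero n)) (zero_add n))
    (fun F n y => y.mapExactFunctor Φ₂) ?_ ?_ ?_
  · exact congrFun (congrFun (congrFun key F) n) y
  · intro S hS n x
    have nat : (hS.map_of_exact Φ₁).extClass.comp (Ext.mk₀ (e.hom.app S.X₁)) (add_zero 1) =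
        (Ext.mk₀ (e.hom.app S.X₃)).comp (hS.map_of_exact Φ₂).extClass (zero_add 1) :=
      (hS.map_of_exact Φ₁).extClass_naturality (hS.map_of_exact Φ₂) (S.mapNatTrans e.hom)
    rw [Ext.mapExactFunctor_comp, Ext.mapExactFunctor_extClass,
      Ext.comp_assoc_of_third_deg_zero]
    erw [nat]
    symm
    rw [Ext.comp_assoc _ _ _ (zero_add n) rfl (by omega), Ext.comp_assoc_of_second_deg_zero]
  · intro S hS n x
    rw [Ext.mapExactFunctor_comp, Ext.mapExactFunctor_extClass]
  · intro F x
    obtain ⟨g, rfl⟩ := (Ext.mk₀_bijective _ _).2 x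
    rw [Ext.mapExactFunctor_mk₀, Ext.mapExactFunctor_mk₀, Ext.mk₀_comp_mk₀, Ext.mk₀_comp_mk₀,
      e.hom.naturality, ← Category.assoc, Iso.inv_hom_id_app, Category.id_comp]

set_option backward.isDefEq.respectTransparency false in
/-- Corollary: `y.map(Φ₁) ∘ e_F = e_A ∘ y.map(Φ₂)` (the form without inverses). [folklore] -/
theorem Ext.mapExactFunctor_comp_mk₀_iso_hom {Φ₁ Φ₂ : C ⥤ D} [Φ₁.Additive]
    [PreservesFiniteLimits Φ₁] [PreservesFiniteColimits Φ₁] [Φ₂.Additive]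
    [PreservesFiniteLimits Φ₂] [PreservesFiniteColimits Φ₂] (e : Φ₁ ≅ Φ₂) {A F : C} {n : ℕ}
    (y : Ext A F n) :
    (y.mapExactFunctor Φ₁).comp (Ext.mk₀ (e.hom.app F)) (add_zero n) =
      (Ext.mk₀ (e.hom.app A)).comp (y.mapExactFunctor Φ₂) (zero_add n) := by
  rw [← Ext.mapExactFunctor_functorIso e y, ← Ext.comp_assoc_of_second_deg_zero,
    Ext.mk₀_comp_mk₀, Iso.hom_inv_id_app, Ext.mk₀_id_comp]

end Literature.AlgebraicGeometry.Motives
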